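import Literature.Analysis.Calculus.LogCutoff
import HarnessLib

/-!
# `WeilGroundState.GroundStatesConvergeToXi` — second derivative of the plateau cutoff `χ_R`
(crux item stmt-RiemannHypothesis-1527, route route-RiemannHypothesis-WeilGroundState; `--supports`)

The tree's plateau cutoff `Literature.Analysis.Calculus.cutoff R s = ρ(s + R) ρ(R − s)`
(`ρ = Real.smoothTransition`; `= 1` on `|s| ≤ R − 1`, `= 0` on `|s| ≥ R`, smooth, first
derivative bounded uniformly in `R`: `SmoothCutoff.lean`, `LogCutoff.lean`) is used to truncate
Riemann's kernel to the window `[-R, R]`. The super-exponential upper bound for the ground energy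
integrates by parts TWICE, so this file adds the second derivative: its closed form
(`hasDerivAt_deriv_cutoff`), continuity, a bound UNIFORM in `R` (`exists_bound_deriv_deriv_cutoff`),
its vanishing on the open plateau, and `tsupport (cutoff R) ⊆ [-R, R]`. No new definitions.
-/

noncomputable section

set_option linter.dupNamespace false

open Set Filter
open scoped Topology

namespace Summit.RiemannHypothesis.RiemannHypothesis.Theorems.GroundStatesConvergeToXi

open Literature.Analysis.Calculus

/-- **Second derivative of the plateau cutoff** (closed form):
`(cutoff R)'' s = ρ''(s+R) ρ(R−s) − 2 ρ'(s+R) ρ'(R−s) + ρ(s+R) ρ''(R−s)`. [folklore] -/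
theorem hasDerivAt_deriv_cutoff (R s : ℝ) :
    HasDerivAt (deriv (cutoff R))
      (deriv (deriv Real.smoothTransition) (s + R) * Real.smoothTransition (R - s) -
        2 * (deriv Real.smoothTransition (s + R) * deriv Real.smoothTransition (R - s)) +
        Real.smoothTransition (s + R) * deriv (deriv Real.smoothTransition) (R - s)) s := by
  have hfun : deriv (cutoff R) = fun s => deriv Real.smoothTransition (s + R) * Real.smoothTransition (R - s) -
      Real.smoothTransition (s + R) * deriv Real.smoothTransition (R - s) := funext (deriv_cutoff R)
  rw [hfun]
  have hd : Differentiable ℝ (deriv Real.smoothTransition) :=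
    contDiff_deriv_smoothTransition.differentiable (by simp)
  have h1 : HasDerivAt (fun s => deriv Real.smoothTransition (s + R))
      (deriv (deriv Real.smoothTransition) (s + R)) s :=
    (hd (s + R)).hasDerivAt.comp_add_const s R
  have h2 : HasDerivAt (fun s => Real.smoothTransition (R - s))
      (-deriv Real.smoothTransition (R - s)) s :=
    (differentiable_smoothTransition (R - s)).hasDerivAt.comp_const_sub R s
  have h3 : HasDerivAt (fun s => Real.smoothTransition (s + R))
      (deriv Real.smoothTransition (s + R)) s :=
    (differentiable_smoothTransition (s + R)).hasDerivAt.comp_add_const s R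
  have h4 : HasDerivAt (fun s => deriv Real.smoothTransition (R - s))
      (-deriv (deriv Real.smoothTransition) (R - s)) s :=
    (hd (R - s)).hasDerivAt.comp_const_sub R s
  exact ((h1.mul h2).sub (h3.mul h4)).congr_deriv (by ring)

/-- The closed form of `deriv (deriv (cutoff R))`. [folklore] -/
theorem deriv_deriv_cutoff (R s : ℝ) : deriv (deriv (cutoff R)) s =
    deriv (deriv Real.smoothTransition) (s + R) * Real.smoothTransition (R - s) -
      2 * (deriv Real.smoothTransition (s + R) * deriv Real.smoothTransition (R - s)) +
      Real.smoothTransition (s + R) * deriv (deriv Real.smoothTransition) (R - s) :=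
  (hasDerivAt_deriv_cutoff R s).deriv

/-- `deriv (cutoff R)` is continuous. [folklore] -/
theorem continuous_deriv_cutoff (R : ℝ) : Continuous (deriv (cutoff R)) :=
  (contDiff_cutoff R (n := 2)).continuous_deriv (by norm_num)

/-- `deriv (deriv (cutoff R))` is continuous. [folklore] -/
theorem continuous_deriv_deriv_cutoff (R : ℝ) : Continuous (deriv (deriv (cutoff R))) :=
  ((contDiff_cutoff R (n := 2)).iterate_deriv' 1 1).continuous_deriv le_rfl

/-- **Uniform bound for the second derivative of the cutoff**: `|(cutoff R)'' s| ≤ D` with `D`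
independent of `R` (from the common bound for `|ρ'|`, `|ρ''|` and `0 ≤ ρ ≤ 1`). [folklore] -/
theorem exists_bound_deriv_deriv_cutoff : ∃ D : ℝ, 0 ≤ D ∧ ∀ R s, |deriv (deriv (cutoff R)) s| ≤ D := by
  obtain ⟨C, hC0, hC1, hC2⟩ := exists_abs_deriv_and_deriv_deriv_smoothTransition_le
  refine ⟨C + 2 * (C * C) + C, by positivity, fun R s => ?_⟩
  rw [deriv_deriv_cutoff]
  have hρ0 : ∀ x, 0 ≤ Real.smoothTransition x := Real.smoothTransition.nonneg
  have hρ1 : ∀ x, Real.smoothTransition x ≤ 1 := Real.smoothTransition.le_one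
  have e1 : |deriv (deriv Real.smoothTransition) (s + R) * Real.smoothTransition (R - s)| ≤ C := by
    rw [abs_mul, abs_of_nonneg (hρ0 _)]
    exact (mul_le_of_le_one_right (abs_nonneg _) (hρ1 _)).trans (hC2 _)
  have e2 : |2 * (deriv Real.smoothTransition (s + R) * deriv Real.smoothTransition (R - s))| ≤
      2 * (C * C) := by
    rw [abs_mul, abs_two, abs_mul]
    exact mul_le_mul_of_nonneg_left (mul_le_mul (hC1 _) (hC1 _) (abs_nonneg _) hC0) zero_le_two
  have e3 : |Real.smoothTransition (s + R) * deriv (deriv Real.smoothTransition) (R - s)| ≤ C := by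
    rw [abs_mul, abs_of_nonneg (hρ0 _)]
    exact (mul_le_of_le_one_left (abs_nonneg _) (hρ1 _)).trans (hC2 _)
  calc _ ≤ |deriv (deriv Real.smoothTransition) (s + R) * Real.smoothTransition (R - s) -
          2 * (deriv Real.smoothTransition (s + R) * deriv Real.smoothTransition (R - s))| +
        |Real.smoothTransition (s + R) * deriv (deriv Real.smoothTransition) (R - s)| := abs_add_le _ _
    _ ≤ (C + 2 * (C * C)) + C := add_le_add ((abs_sub _ _).trans (add_le_add e1 e2)) e3
    _ = C + 2 * (C * C) + C := by ring

/-- On the open plateau `|s| < R − 1` the second derivative of the cutoff vanishes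
(`deriv (cutoff R)` is locally zero there). [folklore] -/
theorem deriv_deriv_cutoff_eq_zero_of_lt {R s : ℝ} (h : |s| < R - 1) : deriv (deriv (cutoff R)) s = 0 := by
  have heq : deriv (cutoff R) =ᶠ[𝓝 s] fun _ => (0 : ℝ) := by
    have ho : IsOpen {t : ℝ | |t| < R - 1} := isOpen_lt continuous_abs continuous_const
    filter_upwards [ho.mem_nhds h] with t ht
    exact deriv_cutoff_eq_zero_of_lt ht
  rw [heq.deriv_eq, deriv_const]

/-- The topological support of the cutoff lies in `[-R, R]`. [folklore] -/
theorem tsupport_cutoff_subset (R : ℝ) : tsupport (cutoff R) ⊆ Icc (-R) R := by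
  refine closure_minimal (Function.support_subset_iff'.2 fun t ht => ?_) isClosed_Icc
  apply cutoff_eq_zero
  simp only [mem_Icc, not_and_or, not_le] at ht
  rcases ht with h | h
  · linarith [neg_abs_le t]
  · linarith [le_abs_self t]

/-- **Summary used downstream** (one bound for both derivatives, uniform in `R`, with the
vanishing on the open plateau): there is `M ≥ 0` with `|(cutoff R)' s| ≤ M`,
`|(cutoff R)'' s| ≤ M` for all `R, s`, and both vanish when `|s| < R − 1`. [folklore] -/
theorem exists_cutoff_deriv_bounds :
    ∃ M : ℝ, 0 ≤ M ∧ ∀ R s : ℝ, |deriv (cutoff R) s| ≤ M ∧ |deriv (deriv (cutoff R)) s| ≤ M ∧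
      (|s| < R - 1 → deriv (cutoff R) s = 0 ∧ deriv (deriv (cutoff R)) s = 0) := by
  obtain ⟨D₁, hD₁, h₁⟩ := exists_bound_deriv_cutoff
  obtain ⟨D₂, -, h₂⟩ := exists_bound_deriv_deriv_cutoff
  exact ⟨max D₁ D₂, le_max_of_le_left hD₁, fun R s =>
    ⟨(h₁ R s).trans (le_max_left _ _), (h₂ R s).trans (le_max_right _ _), fun hs =>
      ⟨deriv_cutoff_eq_zero_of_lt hs, deriv_deriv_cutoff_eq_zero_of_lt hs⟩⟩⟩

end Summit.RiemannHypothesis.RiemannHypothesis.Theorems.GroundStatesConvergeToXi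

end
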